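import Summits.HubbardSuperconductivity.HubbardSuperconductivity.Theorems.CooperPairDMottWalkBindingWalkQuantumNumbers
import Summits.HubbardSuperconductivity.HubbardSuperconductivity.Theorems.FunctionFieldCertificateWindowInfraredBoundSpinBloch
import Summits.HubbardSuperconductivity.HubbardSuperconductivity.Theorems.JosephsonMirrorJmCuspHalfFilledSimple

/-!
# Route `CooperPairDMottWalk`, crux `BindingWalk` (stmt-HubbardSuperconductivity-1176):
# the Cooper-pair package forces a SINGLET pair at the pure point

Helper file (`--supports stmt-HubbardSuperconductivity-1176`) for the registered line
`Cruxes/BindingWalk/Lines/birth.lean`, stub `stub_dWaveSelection` (S3), continuing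
`CooperPairDMottWalkBindingWalkQuantumNumbers` (space-group quantum numbers) with the `SU(2)`
quantum number. The route's package `CP L H ε z` — (a) binding, (b) unique `(L²-2, S^z=0)` floor
`φ₂`, (c) `z L² ‖φ₀‖²‖φ₂‖² ≤ |⟨φ₂, Δ_d φ₀⟩|²` for every half-filled floor vector `φ₀` — with `z > 0`
forces, at the pure torus `hubbardTorus 2 L t U`:

* `exists_eigenvalue_of_commute` — (abstract) a symmetry `A` of `H` preserving the joint sectors
  acts by a scalar on a non-degenerate sector floor;
* `cooperPackage_sameSpinCasimir'` — the total-spin Casimir `S² = spinSq` takes the SAME value on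
  the half-filled floor `φ₀` and on the two-hole floor `φ₂`: both are `S²`-eigenvectors
  (non-degenerate floors, `[S², H] = 0`), `Δ_d` is a spin scalar (`[S², Δ_d] = 0`,
  `NoGo.spinSq_commute_pairField`) and the amplitude of clause (c) does not vanish — Wigner–Eckart
  for the singlet pair field run backwards;
* `szSector_groundState_spinSq_eq_zero_of_liebTwo` / `halfFilled_groundState_spinSq_eq_zero` — Lieb's Theorem 2 (spin half) in sector form, on any balanced connected bipartite graph / on the even torus
  (`t ≠ 0`, `U > 0`): every `(L², S^z = 0)` floor vector has `S² φ₀ = 0` (tree: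
  `LiebTwo.lieb_repulsive_halfFilling_core`, equinumerous sublattices
  `JosephsonMirror.two_mul_card_filter_torusStagger_eq_one`);
* `cooperPackage_twoHole_singlet` (registered sub-goal stub; binder form `cooperPackage_twoHole_singlet'`) — hence, for even `L`, `t ≠ 0`, `U > 0`, the package makes the
  bound hole pair a SPIN SINGLET, `S² φ₂ = 0`;
* `pureCooperPair_twoHole_singlet` — read off the route's target `PureCooperPair` by name.

References: E. H. Lieb, PRL 62 (1989) 1201, Theorem 2; D. J. Scalapino, Phys. Rep. 250 (1995)
329, §2 (singlet `d_{x²-y²}` pair field); H. Tasaki, Prog. Theor. Phys. 99 (1998) 489, p. 20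
(`SU(2)` selection rules for singlet pairs). Elementary linear algebra over tree theorems; no
definition and no named fact is introduced.
-/

set_option linter.dupNamespace false

noncomputable section

namespace Summit.HubbardSuperconductivity.HubbardSuperconductivity.Theorems.CooperPairDMottWalk

open Matrix Finset Literature.MathematicalPhysics.QuantumLattice Literature.Probability.LatticeModels
open scoped ComplexOrder

/-! ### Abstract: a sector-preserving symmetry acts by a scalar on a non-degenerate floor -/

section Generic

variable {Λ : Type*} [LinearOrder Λ] [Fintype Λ]

/-- If the ground states of `H` in the sector `(N, M)` are proportional, and `A` commutes with `H`
and maps the sector into itself, then every sector ground state is an `A`-eigenvector (possibly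
with eigenvalue `0`). [folklore] -/
theorem exists_eigenvalue_of_commute {H A : Matrix (Finset (Orb Λ)) (Finset (Orb Λ)) ℂ}
    {N : ℕ} {M : ℝ}
    (huniq : ∀ φ φ', IsGroundStateInSector H N M φ → IsGroundStateInSector H N M φ' →
      ∃ a : ℂ, φ' = a • φ)
    (hmem : ∀ v : Fock (Orb Λ), v ∈ szSector N M → A *ᵥ v ∈ szSector N M) (hcomm : Commute A H)
    {φ : Fock (Orb Λ)} (hφ : IsGroundStateInSector H N M φ) : ∃ s : ℂ, A *ᵥ φ = s • φ := by
  by_cases h0 : A *ᵥ φ = 0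
  · exact ⟨0, by rw [h0, zero_smul]⟩
  · refine huniq φ (A *ᵥ φ) hφ ⟨hmem φ hφ.1, h0, ?_⟩
    rw [mulVec_mulVec, ← hcomm.eq, ← mulVec_mulVec, hφ.2.2, mulVec_smul]

omit [LinearOrder Λ] in
/-- The eigenvalue of a Hermitian matrix on a nonzero eigenvector is real (`star s = s`). [folklore] -/
theorem star_eq_self_of_isHermitian_eigen {A : Matrix (Finset (Orb Λ)) (Finset (Orb Λ)) ℂ}
    (hA : Aᴴ = A) {φ : Fock (Orb Λ)} (hφ : φ ≠ 0) {s : ℂ} (hs : A *ᵥ φ = s • φ) : star s = s := by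
  -- `⟨φ, Aφ⟩ = s ‖φ‖²` and `⟨Aφ, φ⟩ = star s ‖φ‖²` coincide for Hermitian `A`
  have h1 : star φ ⬝ᵥ (A *ᵥ φ) = s * (star φ ⬝ᵥ φ) := by
    rw [hs, dotProduct_smul, smul_eq_mul]
  have h2 : star φ ⬝ᵥ (A *ᵥ φ) = star s * (star φ ⬝ᵥ φ) := by
    rw [dotProduct_mulVec, ← conjTranspose_conjTranspose A, ← star_mulVec, hA, hs, star_smul,
      smul_dotProduct, smul_eq_mul]
  have hne : star φ ⬝ᵥ φ ≠ 0 := (dotProduct_star_self_pos_iff.2 hφ).ne'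
  exact mul_right_cancel₀ hne (h2.symm.trans h1)

end Generic

/-! ### The pure torus: equal total spin of the two floors -/

section Torus

variable {L : ℕ} [NeZero L]

/-- **The package forces equal total spin on the two floors.** Let the route's Cooper-pair package
hold with `z > 0` for `hubbardTorus 2 L t U` (written out verbatim). Then there is ONE scalar `s`
with `S² φ₀ = s φ₀` for the half-filled floor vector and `S² φ₂ = s φ₂` for the two-hole floor
vector: both floors are non-degenerate (`halfFilled_groundStates_smul_of_cooperPackage`, clause
(b)), `S²` commutes with `H` and preserves the sectors (so acts by scalars `s₀`, `s₂`), `S²` is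
Hermitian and commutes with `Δ_d`, whence `s₀ ⟨φ₂, Δ_d φ₀⟩ = s₂ ⟨φ₂, Δ_d φ₀⟩` with a non-vanishing
amplitude by clause (c). [cite: Scalapino1995, §2 eq. (2.2)] -/
theorem cooperPackage_sameSpinCasimir' (t U : ℝ) {ε z : ℝ} (hz : 0 < z)
    (hCP : (hubbardTorus 2 L t U).minEnergyOn (szSector (L ^ 2 - 2) 0) +
          (hubbardTorus 2 L t U).minEnergyOn (szSector (L ^ 2) 0) + ε ≤
        2 * (hubbardTorus 2 L t U).minEnergyOn (szSector (L ^ 2 - 1) (1 / 2)) ∧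
      (∀ φ₁ φ₂, IsGroundStateInSector (hubbardTorus 2 L t U) (L ^ 2 - 2) 0 φ₁ →
        IsGroundStateInSector (hubbardTorus 2 L t U) (L ^ 2 - 2) 0 φ₂ → ∃ c : ℂ, φ₂ = c • φ₁) ∧
      (∀ φ₀ φ₂, IsGroundStateInSector (hubbardTorus 2 L t U) (L ^ 2) 0 φ₀ →
        IsGroundStateInSector (hubbardTorus 2 L t U) (L ^ 2 - 2) 0 φ₂ →
          z * (L : ℝ) ^ 2 * (star φ₀ ⬝ᵥ φ₀).re * (star φ₂ ⬝ᵥ φ₂).re ≤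
            ‖star φ₂ ⬝ᵥ (pairField dWaveFormFactor L *ᵥ φ₀)‖ ^ 2))
    {φ₀ φ₂ : Fock (Orb (FermionTorus 2 L))}
    (h₀ : IsGroundStateInSector (hubbardTorus 2 L t U) (L ^ 2) 0 φ₀)
    (h₂ : IsGroundStateInSector (hubbardTorus 2 L t U) (L ^ 2 - 2) 0 φ₂) :
    ∃ s : ℂ, (spinSq : Matrix (Finset (Orb (FermionTorus 2 L))) _ ℂ) *ᵥ φ₀ = s • φ₀ ∧
      (spinSq : Matrix (Finset (Orb (FermionTorus 2 L))) _ ℂ) *ᵥ φ₂ = s • φ₂ := by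
  obtain ⟨-, huniq₂, hamp⟩ := hCP
  have huniq₀ := halfFilled_groundStates_smul_of_cooperPackage hz h₂ hamp
  have hcomm := WindowInfraredBound.spinSq_commute_hubbardTorus (L := L) t U
  obtain ⟨s₀, hs₀⟩ := exists_eigenvalue_of_commute huniq₀
    (fun v hv => WindowInfraredBound.spinSq_mulVec_mem_szSector hv) hcomm h₀
  obtain ⟨s₂, hs₂⟩ := exists_eigenvalue_of_commute huniq₂
    (fun v hv => WindowInfraredBound.spinSq_mulVec_mem_szSector hv) hcomm h₂
  refine ⟨s₀, hs₀, ?_⟩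
  -- the amplitude of clause (c) is nonzero
  have hamp0 : star φ₂ ⬝ᵥ (pairField dWaveFormFactor L *ᵥ φ₀) ≠ 0 := by
    intro h
    have h1 := hamp φ₀ φ₂ h₀ h₂
    rw [h, norm_zero, zero_pow two_ne_zero] at h1
    have hL : (0 : ℝ) < (L : ℝ) ^ 2 := by
      have : (0 : ℝ) < L := Nat.cast_pos.2 (Nat.pos_of_ne_zero (NeZero.ne L))
      positivity
    have hpos₀ : 0 < (star φ₀ ⬝ᵥ φ₀).re :=
      (Complex.pos_iff.1 (dotProduct_star_self_pos_iff.2 h₀.2.1)).1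
    have hpos₂ : 0 < (star φ₂ ⬝ᵥ φ₂).re :=
      (Complex.pos_iff.1 (dotProduct_star_self_pos_iff.2 h₂.2.1)).1
    have : 0 < z * (L : ℝ) ^ 2 * (star φ₀ ⬝ᵥ φ₀).re * (star φ₂ ⬝ᵥ φ₂).re := by positivity
    linarith
  -- `S²` is Hermitian and a spin scalar for `Δ_d`: `s₀ ⟨φ₂, Δ φ₀⟩ = star s₂ ⟨φ₂, Δ φ₀⟩`
  have hH : (spinSq : Matrix (Finset (Orb (FermionTorus 2 L))) _ ℂ)ᴴ = spinSq :=
    LiebTwo.spinSq_conjTranspose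
  have hΔ : Commute (spinSq : Matrix (Finset (Orb (FermionTorus 2 L))) _ ℂ) (pairField dWaveFormFactor L) :=
    Summit.HubbardSuperconductivity.NoGo.spinSq_commute_pairField dWaveFormFactor L
  have key : s₀ * (star φ₂ ⬝ᵥ (pairField dWaveFormFactor L *ᵥ φ₀)) =
      star s₂ * (star φ₂ ⬝ᵥ (pairField dWaveFormFactor L *ᵥ φ₀)) := by
    have h1 : star φ₂ ⬝ᵥ (pairField dWaveFormFactor L *ᵥ (spinSq *ᵥ φ₀)) =
        s₀ * (star φ₂ ⬝ᵥ (pairField dWaveFormFactor L *ᵥ φ₀)) := by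
      rw [hs₀, mulVec_smul, dotProduct_smul, smul_eq_mul]
    have h2 : star φ₂ ⬝ᵥ (pairField dWaveFormFactor L *ᵥ (spinSq *ᵥ φ₀)) =
        star s₂ * (star φ₂ ⬝ᵥ (pairField dWaveFormFactor L *ᵥ φ₀)) := by
      rw [mulVec_mulVec, ← hΔ.eq, ← mulVec_mulVec, dotProduct_mulVec, ← hH, ← star_mulVec, hs₂,
        star_smul, smul_dotProduct, smul_eq_mul]
    exact h1.symm.trans h2
  have hreal : star s₂ = s₂ := star_eq_self_of_isHermitian_eigen hH h₂.2.1 hs₂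
  rw [hreal] at key
  rw [mul_right_cancel₀ hamp0 key]
  exact hs₂

/-- **Lieb's Theorem 2, spin half, in sector language** (any connected bipartite graph with
equinumerous colour classes `|A| = |B| = n`, `t ≠ 0`, `U > 0`): every ground state of
`hamiltonian G t U` in the joint sector `(2n, S^z = 0)` is a spin singlet, `S² φ = 0` — the
`2n`-particle ground eigenspace carries spin `J = 0` (`LiebTwo.lieb_repulsive_halfFilling_core`)
and contains the `S^z = 0` floor (`groundEnergyAt_eq_minEnergyOn_szSector`).
[cite: LiebPRL1989, Theorem 2] -/
theorem szSector_groundState_spinSq_eq_zero_of_liebTwo {Λ : Type*} [LinearOrder Λ] [Fintype Λ]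
    (G : SimpleGraph Λ) [DecidableRel G.Adj] (hG : G.Connected) (A : Finset Λ)
    (hA : ∀ x y : Λ, G.Adj x y → (x ∈ A ↔ y ∉ A)) {n : ℕ} (hΛ : Fintype.card Λ = 2 * n)
    (hAn : A.card + 0 = n) {t U : ℝ} (ht : t ≠ 0) (hU : 0 < U) (φ : Fock (Orb Λ))
    (hφ : IsGroundStateInSector (hamiltonian G t U) (2 * n) 0 φ) :
    spinSq *ᵥ φ = 0 := by
  -- adapted from `JosephsonMirror.szSector_groundStates_smul_of_liebTwo` (spin instead of rank)
  obtain ⟨-, hspin⟩ := LiebTwo.lieb_repulsive_halfFilling_core G hG A hA hΛ hAn t U ht hU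
  have hn_le : n ≤ Fintype.card Λ := by omega
  have hE : (hamiltonian G t U).minEnergyOn (szSector (Λ := Λ) (2 * n) 0) =
      groundEnergy (hamiltonian G t U) (2 * n) :=
    (groundEnergyAt_eq_minEnergyOn_szSector G t U hn_le).symm
  have hmem : φ ∈ LinearMap.ker (Matrix.toLin' (hamiltonian G t U -
        ((groundEnergy (hamiltonian G t U) (2 * n) : ℝ) : ℂ) • 1)) ⊓
      LinearMap.ker (Matrix.toLin' (totalNumber - ((2 * n : ℕ) : ℂ) • (1 : Matrix _ _ ℂ))) := by
    refine (LiebTwo.mem_groundSector_iff G t U (2 * n) _ φ).2 ⟨?_, ((mem_szSector_iff _ _ _).1 hφ.1).1⟩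
    have h := hφ.2.2
    rw [hE] at h
    exact h
  have h := hspin φ hmem
  rw [Nat.cast_zero, zero_mul, zero_smul] at h
  exact h

/-- **Lieb's Theorem 2 in sector form on the even torus.** For even `L`, `t ≠ 0` and `U > 0`, every
ground state of `hubbardTorus 2 L t U` in the joint sector `(L², S^z = 0)` is a spin singlet,
`S² φ₀ = 0`: the even torus is connected (`fermionTorusGraph_connected`) and bipartite
(`torusStagger_eq_neg_of_adj_holds`) with equinumerous sublattices
(`JosephsonMirror.two_mul_card_filter_torusStagger_eq_one`). [cite: LiebPRL1989, Theorem 2] -/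
theorem halfFilled_groundState_spinSq_eq_zero (hL : Even L) {t U : ℝ} (ht : t ≠ 0) (hU : 0 < U)
    {φ : Fock (Orb (FermionTorus 2 L))}
    (hφ : IsGroundStateInSector (hubbardTorus 2 L t U) (L ^ 2) 0 φ) :
    (spinSq : Matrix (Finset (Orb (FermionTorus 2 L))) _ ℂ) *ᵥ φ = 0 := by
  -- adapted from `JosephsonMirror.eventualSimplicity_halfFilling` (same bookkeeping)
  obtain ⟨m, hm⟩ := hL
  set n : ℕ := 2 * m ^ 2 with hn
  have hL2 : L ^ 2 = 2 * n := by rw [hn, hm]; ring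
  have hcard : Fintype.card (FermionTorus 2 L) = 2 * n := by
    rw [hn, hm]
    simp only [FermionTorus, Fintype.card_lex, Fintype.card_fun, Fintype.card_fin]
    ring
  set A : Finset (FermionTorus 2 L) := univ.filter fun x : FermionTorus 2 L => torusStagger x = 1 with hA
  have hmemA : ∀ x, x ∈ A ↔ torusStagger x = 1 := fun x => by
    rw [hA, mem_filter]
    exact ⟨fun h => h.2, fun h => ⟨mem_univ _, h⟩⟩
  have hAadj : ∀ x y : FermionTorus 2 L, (fermionTorusGraph 2 L).Adj x y → (x ∈ A ↔ y ∉ A) := by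
    intro x y hxy
    have h := torusStagger_eq_neg_of_adj_holds ⟨m, hm⟩ hxy
    rw [hmemA, hmemA, h]
    change -torusStagger y = 1 ↔ torusStagger y ≠ 1
    rw [Int.units_ne_iff_eq_neg, neg_eq_iff_eq_neg]
  have hAc : A.card + 0 = n := by
    have h := JosephsonMirror.two_mul_card_filter_torusStagger_eq_one (L := L) ⟨m, hm⟩
    rw [← hA] at h
    omega
  rw [hL2] at hφ
  exact szSector_groundState_spinSq_eq_zero_of_liebTwo (fermionTorusGraph 2 L)
    (fermionTorusGraph_connected 2 L) A hAadj hcard hAc ht hU φ hφ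

/-- **The package makes the bound pair a spin singlet.** For even `L`, `t ≠ 0`, `U > 0`: if the
route's Cooper-pair package holds with `z > 0` for `hubbardTorus 2 L t U`, then every ground state
of the two-hole sector `(L²-2, S^z = 0)` has `S² φ₂ = 0` (equal Casimir with the Lieb-singlet
half-filled floor). [cite: LiebPRL1989, Theorem 2] -/
theorem cooperPackage_twoHole_singlet' (hL : Even L) {t U : ℝ} (ht : t ≠ 0) (hU : 0 < U) {ε z : ℝ}
    (hz : 0 < z)
    (hCP : (hubbardTorus 2 L t U).minEnergyOn (szSector (L ^ 2 - 2) 0) +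
          (hubbardTorus 2 L t U).minEnergyOn (szSector (L ^ 2) 0) + ε ≤
        2 * (hubbardTorus 2 L t U).minEnergyOn (szSector (L ^ 2 - 1) (1 / 2)) ∧
      (∀ φ₁ φ₂, IsGroundStateInSector (hubbardTorus 2 L t U) (L ^ 2 - 2) 0 φ₁ →
        IsGroundStateInSector (hubbardTorus 2 L t U) (L ^ 2 - 2) 0 φ₂ → ∃ c : ℂ, φ₂ = c • φ₁) ∧
      (∀ φ₀ φ₂, IsGroundStateInSector (hubbardTorus 2 L t U) (L ^ 2) 0 φ₀ →
        IsGroundStateInSector (hubbardTorus 2 L t U) (L ^ 2 - 2) 0 φ₂ →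
          z * (L : ℝ) ^ 2 * (star φ₀ ⬝ᵥ φ₀).re * (star φ₂ ⬝ᵥ φ₂).re ≤
            ‖star φ₂ ⬝ᵥ (pairField dWaveFormFactor L *ᵥ φ₀)‖ ^ 2))
    {φ₂ : Fock (Orb (FermionTorus 2 L))}
    (h₂ : IsGroundStateInSector (hubbardTorus 2 L t U) (L ^ 2 - 2) 0 φ₂) :
    (spinSq : Matrix (Finset (Orb (FermionTorus 2 L))) _ ℂ) *ᵥ φ₂ = 0 := by
  -- a half-filled floor vector exists (`szSector_groundState` with `2 * (L²/2) = L²`)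
  obtain ⟨m, hm⟩ := hL
  have hL2 : L ^ 2 = 2 * (2 * m ^ 2) := by rw [hm]; ring
  have hle : 2 * m ^ 2 ≤ Fintype.card (FermionTorus 2 L) := by
    have : Fintype.card (FermionTorus 2 L) = L ^ 2 := by
      simp only [FermionTorus, Fintype.card_lex, Fintype.card_fun, Fintype.card_fin]
    rw [this, hL2]; omega
  obtain ⟨⟨φ₀, h₀⟩, -⟩ := szSector_groundState (fermionTorusGraph 2 L) t U hle
  rw [← hL2] at h₀
  obtain ⟨s, hs₀, hs₂⟩ := cooperPackage_sameSpinCasimir' t U hz hCP (φ₀ := φ₀) h₀ h₂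
  have hzero := halfFilled_groundState_spinSq_eq_zero (L := L) ⟨m, hm⟩ ht hU h₀
  -- `s φ₀ = 0` with `φ₀ ≠ 0` gives `s = 0`
  rw [hzero] at hs₀
  have hs : s = 0 := by
    by_contra hne
    exact h₀.2.1 ((smul_eq_zero_iff_right hne).1 hs₀.symm)
  rw [hs₂, hs, zero_smul]

/-- **Read off the route's target by name.** If `PureCooperPair` holds then, for the `U ∈ [2,8]` and
`k₀` it provides, on every torus of side `4k+4`, `k ≥ k₀`, every ground state of the two-hole sector
`((4k+4)²-2, S^z = 0)` of `hubbardTorus 2 (4k+4) 1 U` is a spin singlet. [cite: LiebPRL1989, Theorem 2] -/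
theorem pureCooperPair_twoHole_singlet
    (h : Summit.HubbardSuperconductivity.HubbardSuperconductivity.Theses.CooperPairDMottWalk.PureCooperPair) :
    ∃ U ∈ Set.Icc (2 : ℝ) 8, ∃ k₀ : ℕ, ∀ k ≥ k₀, ∀ φ₂ : Fock (Orb (FermionTorus 2 (4 * k + 4))),
      IsGroundStateInSector (hubbardTorus 2 (4 * k + 4) 1 U) ((4 * k + 4) ^ 2 - 2) 0 φ₂ →
        (spinSq : Matrix (Finset (Orb (FermionTorus 2 (4 * k + 4)))) _ ℂ) *ᵥ φ₂ = 0 := by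
  obtain ⟨U, hU, ε, -, z, hz, k₀, hK⟩ := h
  refine ⟨U, hU, k₀, fun k hk φ₂ h₂ => ?_⟩
  have hU0 : 0 < U := by linarith [hU.1]
  exact cooperPackage_twoHole_singlet' (L := 4 * k + 4) ⟨2 * k + 2, by ring⟩ one_ne_zero hU0 hz
    (hK k hk) h₂

end Torus

/-! ### The registered sub-goal stub (verbatim signature) -/

/-- **Registered sub-goal stub `cooperPackage_twoHole_singlet`** of the line `registered` for the
crux `BindingWalk` (helper for `stub_dWaveSelection`): for even `L`, `t ≠ 0`, `U > 0`, the
Cooper-pair package with `z > 0` at the pure torus makes every two-hole sector ground state a spin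
singlet. (`cooperPackage_twoHole_singlet'` in binder form.) [cite: LiebPRL1989, Theorem 2] -/
theorem cooperPackage_twoHole_singlet : ∀ {L : ℕ} [NeZero L], Even L → ∀ {t U : ℝ}, t ≠ 0 → 0 < U → ∀ {ε z : ℝ}, 0 < z → ((hubbardTorus 2 L t U).minEnergyOn (szSector (L ^ 2 - 2) 0) + (hubbardTorus 2 L t U).minEnergyOn (szSector (L ^ 2) 0) + ε ≤ 2 * (hubbardTorus 2 L t U).minEnergyOn (szSector (L ^ 2 - 1) (1 / 2)) ∧ (∀ φ₁ φ₂, IsGroundStateInSector (hubbardTorus 2 L t U) (L ^ 2 - 2) 0 φ₁ → IsGroundStateInSector (hubbardTorus 2 L t U) (L ^ 2 - 2) 0 φ₂ → ∃ c : ℂ, φ₂ = c • φ₁) ∧ (∀ φ₀ φ₂, IsGroundStateInSector (hubbardTorus 2 L t U) (L ^ 2) 0 φ₀ → IsGroundStateInSector (hubbardTorus 2 L t U) (L ^ 2 - 2) 0 φ₂ → z * (L : ℝ) ^ 2 * (star φ₀ ⬝ᵥ φ₀).re * (star φ₂ ⬝ᵥ φ₂).re ≤ ‖star φ₂ ⬝ᵥ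 (pairField dWaveFormFactor L *ᵥ φ₀)‖ ^ 2)) → ∀ {φ₂ : Fock (Orb (FermionTorus 2 L))}, IsGroundStateInSector (hubbardTorus 2 L t U) (L ^ 2 - 2) 0 φ₂ → (spinSq : Matrix (Finset (Orb (FermionTorus 2 L))) (Finset (Orb (FermionTorus 2 L))) ℂ) *ᵥ φ₂ = 0 :=
  @fun _ _ hL _ _ ht hU _ _ hz hCP _ h₂ => cooperPackage_twoHole_singlet' hL ht hU hz hCP h₂

end Summit.HubbardSuperconductivity.HubbardSuperconductivity.Theorems.CooperPairDMottWalk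

end
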